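import Literature.NumberTheory.EllipticCurves.OrdinaryNewformDatumCofreeUnramified
import Literature.NumberTheory.Automorphic.BCDTTheoremBWildAtThreeDet
import Literature.NumberTheory.GaloisRepresentations.CyclotomicLevels
import HarnessLib

/-!
# Route ByReductionTypeAtTwo, crux `OrdKatoHalfAtTwoIso` (stmt-BirchSwinnertonDyer-19573), line `steinberg-fibre-at-two`
# (skeleton v11), stub `stub_coreA_posDisc : CoreTheoremAPosDiscTwo` (child 23967) — plan item (P3c): a Frobenius FIXING `√−1`
# sits above a prime `q ≡ 1 (mod 4)` (`4 ∣ ℓ − 1`), the arithmetic hypothesis of the real-zero Kolyvagin package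
# (`exists_kolyvaginPackage_two_realZero`, p688788)

Seat `cruxlead-stmt-BirchSwinnertonDyer-19573-g5` (LEAD PROVER, MODE LINE; HOME `run/shared/lean/pub/bsd-2adic/`; `--supports`
stmt-BirchSwinnertonDyer-19573 as helper). THEOREMS ONLY; nothing asserted; BSD is not proved by any of this; the crux and the stub are
NOT proved here. The H-C⁺ step of the brief (P3) will deliver Kolyvagin primes `q` whose Frobenius lies in `rootsOfUnityFixer ℚ 4`
(Rubin's `τ`, p682874, fixes `i`); this file converts that into the divisibility `4 ∣ ℓ − 1` consumed by p688788, via the tree's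
`Rat.modNCyclotomicCharacter_of_isArithFrobAt` (`χ_N(Frob_𝔓) = ℓ (mod N)`) and `rootsOfUnityFixer_eq_ker`.

References: L. Washington, *Introduction to Cyclotomic Fields* (1997) Lemma 2.12 ff. [Washington1997]; J. Neukirch, *Algebraic Number
Theory* (1999) VII §5 [NeukirchANT1999]; tree `BCDTTheoremBWildAtThreeDet.lean` (`Rat.modNCyclotomicCharacter_of_isArithFrobAt`),
`CyclotomicLevels.lean` (`rootsOfUnityFixer_eq_ker`), `OrdinaryNewformDatumCofreeUnramified.lean` (`natCast_primesEquiv_mem_asIdeal`).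
-/

set_option autoImplicit false
-- the summit and its single problem are both named `BirchSwinnertonDyer` (registry layout D-0017)
set_option linter.dupNamespace false

open IsDedekindDomain NumberField
open scoped NumberField
open Literature.NumberTheory.GaloisRepresentations Literature.NumberTheory.EllipticCurves

namespace Summit.BirchSwinnertonDyer.BirchSwinnertonDyer.Rank1Residual.KolyvaginTwist

/-- **A Frobenius fixing `μ_4` sits above `q ≡ 1 (mod 4)`**: for a finite place `q` of `ℚ` with residue characteristic `ℓ ≠ 2`, a
prime `𝔓` of `ℤ̄` above `q` and an arithmetic Frobenius `Fr` at `𝔓`, if `Fr ∈ Gal(ℚ̄/ℚ(μ_4))` then `4 ∣ ℓ − 1`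
(`χ_4(Fr) = ℓ (mod 4)` and `χ_4(Fr) = 1`). The hypothesis `4 ∣ ℓ − 1` of `exists_kolyvaginPackage_two_realZero` (p688788) for the
Kolyvagin primes produced by H-C from Rubin's `τ` (`τ·i = i`, p682874). [cite: Washington1997, Lemma 2.12 ff.] -/
theorem four_dvd_sub_one_of_isArithFrobAt_of_mem_rootsOfUnityFixer (q : HeightOneSpectrum (𝓞 ℚ))
    (hℓ2 : ((Rat.HeightOneSpectrum.primesEquiv q : Nat.Primes) : ℕ) ≠ 2)
    {𝔓 : Ideal (absIntegers (𝓞 ℚ) ℚ)} (h𝔓 : 𝔓 ∈ q.primesAbove) {Fr : Field.absoluteGaloisGroup ℚ}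
    (hFr : IsArithFrobAt (𝓞 ℚ) Fr 𝔓) (hR4 : Fr ∈ rootsOfUnityFixer ℚ 4) :
    4 ∣ ((Rat.HeightOneSpectrum.primesEquiv q : Nat.Primes) : ℕ) - 1 := by
  set ℓ : ℕ := ((Rat.HeightOneSpectrum.primesEquiv q : Nat.Primes) : ℕ) with hℓ
  have hℓp : ℓ.Prime := (Rat.HeightOneSpectrum.primesEquiv q).2
  -- `ℓ ∤ 4` (`ℓ` is an odd prime)
  have hℓ4 : ¬ ℓ ∣ 4 := by
    intro h
    have h4 : (4 : ℕ) = 2 ^ 2 := by norm_num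
    rw [h4] at h
    exact hℓ2 ((Nat.prime_dvd_prime_iff_eq hℓp Nat.prime_two).mp (hℓp.dvd_of_dvd_pow h))
  haveI : NeZero (4 : ℕ) := ⟨by norm_num⟩
  haveI : NeZero ((4 : ℕ) : ℚ) := ⟨by norm_num⟩
  -- `χ_4(Fr) = ℓ (mod 4)` and `χ_4(Fr) = 1`
  have hχ := Rat.modNCyclotomicCharacter_of_isArithFrobAt (N := 4) hℓp hℓ4 (natCast_primesEquiv_mem_asIdeal q) h𝔓 hFr
  rw [rootsOfUnityFixer_eq_ker, MonoidHom.mem_ker] at hR4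
  rw [hR4, Units.val_one] at hχ
  -- `(ℓ : ZMod 4) = 1 ⇒ ℓ % 4 = 1 ⇒ 4 ∣ ℓ − 1`
  have hmod : ℓ % 4 = 1 := by
    have h := (ZMod.natCast_eq_natCast_iff' ℓ 1 4).mp (by rw [Nat.cast_one]; exact hχ.symm)
    simpa using h
  omega

end Summit.BirchSwinnertonDyer.BirchSwinnertonDyer.Rank1Residual.KolyvaginTwist
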